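import Summits.Parity.GeneralizedHardyLittlewood.Theorems.LeeYangFibresRelativeDimOneDefs
import Mathlib.NumberTheory.Primorial
import HarnessLib

/-!
# Route `LeeYangFibres`, crux `RelativeDimOne` (stmt-Parity-14113), line `SketchIdeator1` =
`translate-amplification`: small facts for the glue `stub_singularMeanGlue` (part 2)

Sorry-free auxiliary facts over the vocabulary `LeeYangFibresRelativeDimOneDefs.lean`, used by
`LeeYangFibresRelativeDimOneSingularMeanGlue.lean`:

* the cube decomposition of the shift box (`sum_shiftBox_eq_sum_cubes`, `card_cube`,
  `card_cubeIndex`);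
* `localAverage_primorial` — `LocalAverage` restated over cubes of side the primorial `∏_{p ≤ y} p`:
  `∑_{H ∈ a + [0,P)^m} ∏_{p ≤ y} β_p(Ψ^{(H)}) = P^m (∏_{p ≤ y} β_p(Ψ))^{m+1}`;
* `cube_estimate` — on one cube, a `2`-Lipschitz weight `w` is constant up to `2 m P`, so
  `|∑_{cube} w F − F₀ ∑_{cube} w| ≤ 4 m P · P^m F₀` when `∑_{cube} F = P^m F₀`, `F ≥ 0`;
* `shiftBox_sum_mul_sub_le` — summed over the cubes covering the shift box:
  `|∑_{box} w F − F₀ ∑_{box} w| ≤ (2R+1)^m · 4 m P · P^m F₀`;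
* `sum_mul_le_card_mul` — the trivial bound for the degenerate shifts.
-/

noncomputable section

open scoped BigOperators Classical Topology
open Finset Filter MeasureTheory Literature.NumberTheory.Sieve

namespace Summit.Parity.GeneralizedHardyLittlewood.Cruxes.RelativeDimOne.TranslateAmplification

variable {t m : ℕ}

/-! ### Cubes of side `P` covering the shift box -/

/-- Floor division locates the block: `c P ≤ h < c P + P` forces `h / P = c`. -/
theorem ediv_eq_of_mem_block {P c h : ℤ} (hP : 0 < P) (h1 : c * P ≤ h) (h2 : h < c * P + P) :
    h / P = c := by
  have hlo : c ≤ h / P := (Int.le_ediv_iff_mul_le hP).mpr h1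
  have hhi : h / P < c + 1 := (Int.ediv_lt_iff_lt_mul hP).mpr (by linarith [add_one_mul c P])
  omega

/-- Every integer lies in its own block: `(h / P) P ≤ h < (h / P) P + P`. -/
theorem mem_block_ediv {P : ℤ} (hP : 0 < P) (h : ℤ) : h / P * P ≤ h ∧ h < h / P * P + P := by
  have h1 := Int.ediv_mul_add_emod h P
  have h2 := Int.emod_nonneg h hP.ne'
  have h3 := Int.emod_lt_of_pos h hP
  constructor <;> linarith

/-- **Cube decomposition of the shift box.** If `g` vanishes off the shift box `[-2N, 2N]^m` and
`2N < R P`, then `∑_{H ∈ shift box} g(H) = ∑_{c ∈ [-R, R]^m} ∑_{H ∈ c P + [0, P)^m} g(H)`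
(the cubes `c P + [0, P)^m` are pairwise disjoint and cover the shift box). -/
theorem sum_shiftBox_eq_sum_cubes {N P R : ℕ} (hP : 0 < P) (hR : 2 * N < R * P)
    (g : (Fin m → ℤ) → ℝ) (hg : ∀ H, H ∉ shiftBox m N → g H = 0) :
    ∑ H ∈ shiftBox m N, g H =
      ∑ c ∈ Fintype.piFinset (fun _ : Fin m => Finset.Icc (-(R : ℤ)) R),
        ∑ H ∈ Fintype.piFinset (fun j : Fin m => Finset.Ico (c j * P) (c j * P + P)), g H := by
  have hPz : (0 : ℤ) < P := by exact_mod_cast hP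
  have hRz : (2 * N : ℤ) < R * P := by exact_mod_cast hR
  set C := Fintype.piFinset (fun _ : Fin m => Finset.Icc (-(R : ℤ)) R) with hC
  set Q : (Fin m → ℤ) → Finset (Fin m → ℤ) := fun c =>
    Fintype.piFinset (fun j : Fin m => Finset.Ico (c j * P) (c j * P + P)) with hQ
  -- the cubes are pairwise disjoint
  have hdisj : (C : Set (Fin m → ℤ)).PairwiseDisjoint Q := by
    intro c _ c' _ hne
    refine Finset.disjoint_left.mpr fun H h1 h2 => hne (funext fun j => ?_)
    have hj1 := Finset.mem_Ico.mp (Fintype.mem_piFinset.mp h1 j)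
    have hj2 := Finset.mem_Ico.mp (Fintype.mem_piFinset.mp h2 j)
    rw [← ediv_eq_of_mem_block hPz hj1.1 hj1.2, ← ediv_eq_of_mem_block hPz hj2.1 hj2.2]
  -- and cover the shift box
  have hcover : shiftBox m N ⊆ C.biUnion Q := by
    intro H hH
    rw [shiftBox, Fintype.mem_piFinset] at hH
    refine Finset.mem_biUnion.mpr ⟨fun j => H j / P, ?_, ?_⟩
    · refine Fintype.mem_piFinset.mpr fun j => Finset.mem_Icc.mpr ⟨?_, ?_⟩
      · have hj := (Finset.mem_Icc.mp (hH j)).1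
        rw [Int.le_ediv_iff_mul_le hPz]
        linarith
      · have hj := (Finset.mem_Icc.mp (hH j)).2
        have : H j / P < R + 1 := by
          rw [Int.ediv_lt_iff_lt_mul hPz]
          nlinarith
        omega
    · exact Fintype.mem_piFinset.mpr fun j =>
        Finset.mem_Ico.mpr (mem_block_ediv hPz (H j))
  rw [← Finset.sum_biUnion hdisj]
  exact Finset.sum_subset hcover fun H _ hH => hg H hH

/-- A cube of side `P` in `ℤ^m` has `P^m` points. -/
theorem card_cube (P : ℕ) (a : Fin m → ℤ) :
    #(Fintype.piFinset (fun j : Fin m => Finset.Ico (a j) (a j + P))) = P ^ m := by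
  rw [Fintype.card_piFinset]
  simp only [Int.card_Ico, add_sub_cancel_left, Int.toNat_natCast, Finset.prod_const,
    Finset.card_univ, Fintype.card_fin]

/-- The index box `[-R, R]^m` has `(2R+1)^m` points. -/
theorem card_cubeIndex : ∀ (m R : ℕ), #(Fintype.piFinset (fun _ : Fin m => Finset.Icc (-(R : ℤ)) R)) = (2 * R + 1) ^ m := by
  intro m R
  rw [Fintype.card_piFinset, Finset.prod_const, Finset.card_univ, Fintype.card_fin, Int.card_Icc]
  congr 1
  omega

/-! ### Local averages over primorial cubes -/

/-- `LocalAverage` for the primes `p ≤ y` and the cube `a + [0, P)^m`, `P = ∏_{p ≤ y} p` the primorial: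
`∑_{H ∈ a + [0,P)^m} ∏_{p ≤ y} β_p(Ψ^{(H)}) = P^m (∏_{p ≤ y} β_p(Ψ))^{m+1}`. -/
theorem localAverage_primorial (hA : LocalAverage) (m : ℕ) (Ψ : Fin t → AffLinForm 1) (y : ℕ)
    (a : Fin m → ℤ) :
    ∑ H ∈ Fintype.piFinset (fun j : Fin m => Finset.Ico (a j) (a j + (primorial y : ℕ))),
        singularProductPartial (translateFamily Ψ H) y =
      ((primorial y : ℕ) : ℝ) ^ m * singularProductPartial Ψ y ^ (m + 1) := by
  have h := hA m t Ψ (Nat.primesLE y) (fun p hp => Nat.prime_of_mem_primesLE hp) a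
  have hcast : (∏ p ∈ Nat.primesLE y, (p : ℤ)) = ((primorial y : ℕ) : ℤ) := by
    rw [primorial_eq_prod_primesLE]
    push_cast
    rfl
  rw [hcast] at h
  unfold singularProductPartial
  rw [h, primorial_eq_prod_primesLE, Finset.prod_pow]

/-! ### One cube -/

/-- **One cube.** For `F ≥ 0` with `∑_{H ∈ a + [0,P)^m} F(H) = P^m F₀` and a weight `w` with
`|w(H) − w(H')| ≤ 2 ∑_j |H_j − H'_j|`:
`|∑_{cube} w F − F₀ ∑_{cube} w| ≤ 4 m P · P^m F₀` (compare both sums with `w(a)`). -/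
theorem cube_estimate (P : ℕ) (a : Fin m → ℤ) (w F : (Fin m → ℤ) → ℝ) (F0 : ℝ)
    (hF : ∀ H, 0 ≤ F H) (hF0 : 0 ≤ F0)
    (hw : ∀ H H' : Fin m → ℤ, |w H - w H'| ≤ 2 * ∑ j, |((H j : ℤ) : ℝ) - (H' j : ℝ)|)
    (hsum : ∑ H ∈ Fintype.piFinset (fun j : Fin m => Finset.Ico (a j) (a j + P)), F H =
      (P : ℝ) ^ m * F0) :
    |∑ H ∈ Fintype.piFinset (fun j : Fin m => Finset.Ico (a j) (a j + P)), w H * F H -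
        F0 * ∑ H ∈ Fintype.piFinset (fun j : Fin m => Finset.Ico (a j) (a j + P)), w H| ≤
      4 * m * P * ((P : ℝ) ^ m * F0) := by
  set Q := Fintype.piFinset (fun j : Fin m => Finset.Ico (a j) (a j + (P : ℤ))) with hQ
  have hlip : ∀ H ∈ Q, |w H - w a| ≤ 2 * m * P := by
    intro H hH
    refine (hw H a).trans ?_
    have hj : ∀ j, |((H j : ℤ) : ℝ) - (a j : ℝ)| ≤ P := fun j => by
      have hj := Finset.mem_Ico.mp (Fintype.mem_piFinset.mp hH j)
      have h1 : ((a j : ℤ) : ℝ) ≤ H j := by exact_mod_cast hj.1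
      have h2 : ((H j : ℤ) : ℝ) < a j + P := by exact_mod_cast hj.2
      rw [abs_le]
      constructor <;> linarith
    calc 2 * ∑ j, |((H j : ℤ) : ℝ) - (a j : ℝ)| ≤ 2 * ∑ _j : Fin m, (P : ℝ) := by
          gcongr with j
          exact hj j
      _ = 2 * m * P := by
          rw [Finset.sum_const, Finset.card_univ, Fintype.card_fin, nsmul_eq_mul]
          ring
  have hcard : (#Q : ℝ) = (P : ℝ) ^ m := by
    rw [hQ, Fintype.card_piFinset]
    simp only [Int.card_Ico, add_sub_cancel_left, Int.toNat_natCast, Finset.prod_const,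
      Finset.card_univ, Fintype.card_fin]
    push_cast
    ring
  have hid : ∑ H ∈ Q, w H * F H - F0 * ∑ H ∈ Q, w H =
      ∑ H ∈ Q, (w H - w a) * F H - F0 * ∑ H ∈ Q, (w H - w a) := by
    have h1 : ∑ H ∈ Q, (w H - w a) * F H = ∑ H ∈ Q, w H * F H - w a * ∑ H ∈ Q, F H := by
      rw [Finset.mul_sum, ← Finset.sum_sub_distrib]
      exact Finset.sum_congr rfl fun H _ => by ring
    have h2 : ∑ H ∈ Q, (w H - w a) = ∑ H ∈ Q, w H - #Q * w a := by
      rw [Finset.sum_sub_distrib, Finset.sum_const, nsmul_eq_mul]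
    rw [h1, h2, hsum, hcard]
    ring
  rw [hid]
  calc |∑ H ∈ Q, (w H - w a) * F H - F0 * ∑ H ∈ Q, (w H - w a)|
      ≤ |∑ H ∈ Q, (w H - w a) * F H| + |F0 * ∑ H ∈ Q, (w H - w a)| := abs_sub _ _
    _ ≤ 2 * m * P * ∑ H ∈ Q, F H + F0 * (#Q * (2 * m * P)) := by
        gcongr
        · calc |∑ H ∈ Q, (w H - w a) * F H| ≤ ∑ H ∈ Q, |(w H - w a) * F H| :=
                Finset.abs_sum_le_sum_abs _ _
            _ ≤ ∑ H ∈ Q, 2 * m * P * F H := Finset.sum_le_sum fun H hH => by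
                rw [abs_mul, abs_of_nonneg (hF H)]
                exact mul_le_mul_of_nonneg_right (hlip H hH) (hF H)
            _ = 2 * m * P * ∑ H ∈ Q, F H := (Finset.mul_sum _ _ _).symm
        · rw [abs_mul, abs_of_nonneg hF0]
          refine mul_le_mul_of_nonneg_left ?_ hF0
          calc |∑ H ∈ Q, (w H - w a)| ≤ ∑ H ∈ Q, |w H - w a| := Finset.abs_sum_le_sum_abs _ _
            _ ≤ ∑ _H ∈ Q, 2 * (m : ℝ) * P := Finset.sum_le_sum hlip
            _ = #Q * (2 * m * P) := by rw [Finset.sum_const, nsmul_eq_mul]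
    _ = 4 * m * P * ((P : ℝ) ^ m * F0) := by
        rw [hsum, hcard]
        ring

/-! ### Trivial bounds -/

/-- `0 ≤ ∑_{H ∈ D} w F ≤ #D · W · Y` for `0 ≤ w ≤ W`, `0 ≤ F ≤ Y`. -/
theorem sum_mul_le_card_mul (D : Finset (Fin m → ℤ)) (w F : (Fin m → ℤ) → ℝ) {W Y : ℝ}
    (hw : ∀ H, 0 ≤ w H ∧ w H ≤ W) (hF : ∀ H, 0 ≤ F H ∧ F H ≤ Y) :
    0 ≤ ∑ H ∈ D, w H * F H ∧ ∑ H ∈ D, w H * F H ≤ #D * (W * Y) := by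
  refine ⟨Finset.sum_nonneg fun H _ => mul_nonneg (hw H).1 (hF H).1, ?_⟩
  calc ∑ H ∈ D, w H * F H ≤ ∑ _H ∈ D, W * Y :=
        Finset.sum_le_sum fun H _ => mul_le_mul (hw H).2 (hF H).2 (hF H).1 ((hw H).1.trans (hw H).2)
    _ = #D * (W * Y) := by rw [Finset.sum_const, nsmul_eq_mul]

/-- **All cubes.** If moreover `w` vanishes off the shift box and `2N < R P`, summing `cube_estimate`
over the `(2R+1)^m` cubes `c P + [0,P)^m`, `c ∈ [-R, R]^m`, covering the shift box:
`|∑_{H ∈ box} w F − F₀ ∑_{H ∈ box} w| ≤ (2R+1)^m · 4 m P · P^m F₀`. -/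
theorem shiftBox_sum_mul_sub_le {N P R : ℕ} (hP : 0 < P) (hR : 2 * N < R * P)
    (w F : (Fin m → ℤ) → ℝ) (F0 : ℝ) (hF : ∀ H, 0 ≤ F H) (hF0 : 0 ≤ F0)
    (hw : ∀ H H' : Fin m → ℤ, |w H - w H'| ≤ 2 * ∑ j, |((H j : ℤ) : ℝ) - (H' j : ℝ)|)
    (hw0 : ∀ H, H ∉ shiftBox m N → w H = 0)
    (hsum : ∀ a : Fin m → ℤ,
      ∑ H ∈ Fintype.piFinset (fun j : Fin m => Finset.Ico (a j) (a j + P)), F H = (P : ℝ) ^ m * F0) :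
    |∑ H ∈ shiftBox m N, w H * F H - F0 * ∑ H ∈ shiftBox m N, w H| ≤
      (2 * R + 1) ^ m * (4 * m * P * ((P : ℝ) ^ m * F0)) := by
  rw [sum_shiftBox_eq_sum_cubes hP hR (fun H => w H * F H) (fun H hH => by rw [hw0 H hH, zero_mul]),
    sum_shiftBox_eq_sum_cubes hP hR w hw0, Finset.mul_sum, ← Finset.sum_sub_distrib]
  set C := Fintype.piFinset (fun _ : Fin m => Finset.Icc (-(R : ℤ)) R) with hC
  calc |∑ c ∈ C, (∑ H ∈ Fintype.piFinset (fun j : Fin m => Finset.Ico (c j * P) (c j * P + P)),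
            w H * F H -
          F0 * ∑ H ∈ Fintype.piFinset (fun j : Fin m => Finset.Ico (c j * P) (c j * P + P)), w H)|
      ≤ ∑ c ∈ C, |∑ H ∈ Fintype.piFinset (fun j : Fin m => Finset.Ico (c j * P) (c j * P + P)),
            w H * F H -
          F0 * ∑ H ∈ Fintype.piFinset (fun j : Fin m => Finset.Ico (c j * P) (c j * P + P)), w H| :=
        Finset.abs_sum_le_sum_abs _ _
    _ ≤ ∑ _c ∈ C, 4 * m * P * ((P : ℝ) ^ m * F0) :=
        Finset.sum_le_sum fun c _ => cube_estimate P (fun j => c j * P) w F F0 hF hF0 hw (hsum _)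
    _ = (2 * R + 1) ^ m * (4 * m * P * ((P : ℝ) ^ m * F0)) := by
        rw [Finset.sum_const, hC, card_cubeIndex m R, nsmul_eq_mul]
        push_cast
        ring

end Summit.Parity.GeneralizedHardyLittlewood.Cruxes.RelativeDimOne.TranslateAmplification
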